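import Summits.BirchSwinnertonDyer.Rank1Residual.AdditivePotMult.RamifiedOrdinaryLineMatching
import Summits.BirchSwinnertonDyer.Rank1Residual.AdditivePotMult.PotMultCongruentPartnerEPW
import Summits.BirchSwinnertonDyer.Rank1Residual.Additive.GordRamifiedOrdinaryLinePair
import HarnessLib

/-!
# LINE-MATCHING IS AUTOMATIC on MIXED (G-ord, e = 2) × (M) congruent pairs at the same odd `p`, and
# the Route-G budget of an X4(M) row from a (G-ord) congruent partner (cell `b2b-bsdres`, team n1011,
# seat p07 (gen 4), row TB-ROL FILE C′; sequel of `RamifiedOrdinaryLineMatching.lean` and of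
# n1011-p10's `Additive/GordRamifiedOrdinaryLinePair.lean`)

HONEST FRAMING (cell `b2b-bsdres`, run/shared/lean/b2b/bsd-rank1-residual/, verbatim in every
file): the goal of the cell is to DELETE the COMBINATION-SHAPED residual classes of the
Birch–Swinnerton-Dyer formula for ALL analytic-rank `≤ 1` elliptic curves over `ℚ` — "full BSD
formula for every rank `≤ 1` curve in class `C`" assembled STRICTLY from published theorems — so
that the rank-`≤ 1` remainder becomes exactly the CONSTRUCTION-SHAPED classes, which are TYPED
(missing-input `Prop`s), NOT attempted. This is not "finishing BSD". Team n1011 (RESIDUAL-MAP §I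
N10 / N11 LOWER; Route G's EPW consumers): research route; labels and marks UNCHANGED; nothing
booked. Theorems only; NO definition; NO new named fact. The (M) side is CONDITIONAL on the tree's
EXISTING named facts A40/A41 (Silverman *ATAEC* V.3.1 / V.5.3 / V.5.4, hypotheses `hT40`, `hT41`);
the (G-ord) side is unconditional; §3 additionally takes `hEPW` (the EPW transfer) as FILE 3 does.

## What and why

An additive pair `(E,p)` of semistability defect `e = 2` at the odd prime `p` is `V ⊗ χ_{p*}` with `V`
either good ordinary ((G-ord) ∩ `I₀*`) or multiplicative ((M)) at `p`; in BOTH cases the inertial type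
is `(ω·ω^{(p−1)/2}, ω^{(p−1)/2})`, so EPW's transfer on the branch `a = (p−1)/2` relates members of
either kind (n1011-lit C-audit N1 of cc-typer-1's fact: "no second EPW fact is needed for (M)-pairs or
mixed (pot-ordinary `e = 2`, pot-multiplicative) congruent pairs"). The ramified ordinary lines were
built separately — (G-ord): Greenberg's reduction datum transported (n1011-p10,
`GordRamifiedOrdinaryLine`, here re-read through this seat's explicit `twistMap`/`twistTransport`
so that both lines carry the same sign bookkeeping `galRange K`); (M): the Tate line transported
(`RamifiedOrdinaryLinePotMult`) — and each carries the inertia signature that forces matching: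
QUOTIENT SHAPE (`res σ • x ∓ x ∈ C` for every inertia `σ`, both kinds: `reductionDatum_htriv` /
`tateDatum_htriv`) and LINE SHAPE at ONE inertia element acting as `±2` on `C[p]` ((G-ord): p10's
`exists_mem_absInertia_smul_eq_two_nsmul`, from X2's Weil-pairing lemma
`exists_generator_and_inertia_smul_eq_two`; (M): `χ_p(σ₁) = 2` on `μ_p`). Since the two directions of
the matching may use DIFFERENT inertia elements (`RamifiedOrdinaryLineMatching.inclusion_apply_mem_of_pos/_neg`
need the line shape on the source and the quotient shape on the target only), the mixed case follows:

* §1 `exists_isRamifiedOrdinaryLine_shape_of_goodOrd_twist` — the (G-ord) line with its shape, in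
  this seat's transport language (inputs BY NAME: p10's `reductionDatum_divisible / _plus_ne_top /
  _plus_ne_bot`, `exists_mem_absInertia_smul_eq_two_nsmul`; X2's `reductionDatum_htriv`).
* §2 **`exists_lines_matching_of_goodOrd_mult_twists`** — `C • V^{(c)} = W` (`V` good ordinary),
  `C₁ • V₁^{(c)} = W₁` (`V₁` multiplicative), `ord_p c = 1`: `∃ L L₁`, both `IsRamifiedOrdinaryLine`,
  and EVERY `Γ_ℚ`-equivariant `W[p] ≃+ W₁[p]` respects them; class level
  **`exists_lines_matching_of_typeGOrd_potMult`** (binders `TypeGOrd W p ∧ Addv W p ∧ e(W) = 2`,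
  `PotMult W₁ p`) and the flipped form.
* §3 **`ClassX4M.budgetLeLambdaAt_of_epw_of_gordTypePartner_of_congr`** — Route G's budget for an
  X4(M) row from a (G-ord, `e = 2`) congruent partner: a PLAIN congruence + `Σ₀` + the partner's
  λ-input `h₁` (abstract, the shape of FILE 3 §1; n1011-p10's partner packages supply it on
  X4♯(G-ord) rows) — lines and matching DISCHARGED.

What is NOT claimed: congruent pairs with one member SEMISTABLE at `p` (no transport in print —
cc-typer-1 N11/TRANSPORT v5, the missing LINE-SWITCH law); `e ∈ {3,4,6}` rows; `p = 2`. Everything is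
PER PAIR modulo the named facts; X4(M) / X4♯(G-ord) stay CONSTRUCTION-SHAPED; nothing booked.

References: M. Emerton, R. Pollack, T. Weston, Invent. Math. 163 (2006) pp. 2–3, §3.1, Thms. 3.3.2,
3.3.3, Lemma 5.1.5; R. Greenberg, LNM 1716 (1999) §2 pp. 63, 69–70; R. Greenberg, V. Vatsal, Invent.
Math. 142 (2000) §2 pp. 14–15, 26; J. H. Silverman, *ATAEC* V.5.3–5.4, *AEC* III.8.1, X.5 Cor. 5.4.
-/

noncomputable section

open scoped Classical NumberField AddSubgroup

universe u

namespace Summit.BirchSwinnertonDyer.Rank1Residual.AdditivePotMult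

open NumberField IsDedekindDomain Field WeierstrassCurve
  Literature.NumberTheory.EllipticCurves
  Literature.NumberTheory.EllipticCurves.GreenbergSelmer
  Literature.NumberTheory.EllipticCurves.GreenbergVatsal2000
  Literature.NumberTheory.EllipticCurves.EmertonPollackWeston2006
  Literature.NumberTheory.GaloisRepresentations
  Literature.NumberTheory.EllipticCurves.Rank1Residual
  Summit.BirchSwinnertonDyer.Rank1Residual.X2
  Summit.BirchSwinnertonDyer.Rank1Residual.X2.GreenbergVatsalReductionDatum
  Summit.BirchSwinnertonDyer.Rank1Residual.X2.GreenbergVatsalTateDatumTorsion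
  Summit.BirchSwinnertonDyer.Rank1Residual.GaloisImage.RamifiedOrdinaryLineTwist
  Summit.BirchSwinnertonDyer.Rank1Residual.Additive
open WeierstrassCurve (minimalDiscriminantInt)

namespace RamifiedOrdinaryLineMatchingMixed

/-! ### §1 The (G-ord) line through `twistMap` / `twistTransport`, with its inertia shape -/

section Gord

variable (V : WeierstrassCurve ℚ) [V.IsGloballyMinimal] [V.IsElliptic] (K : Type) [Field K]
  [NumberField K] (h2 : Module.finrank ℚ K = 2) {θ : K} {c : ℚ} (hθ : θ ∉ Set.range (algebraMap ℚ K))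
  (hc : θ ^ 2 = algebraMap ℚ K c) (p : ℕ) [hp : Fact p.Prime] {W : WeierstrassCurve ℚ}
  {C : VariableChange ℚ} (hC : C • V.quadraticTwist c = W)

include h2 hθ hc hC in
/-- **The (G-ord) ramified ordinary line WITH ITS INERTIA SHAPE — UNCONDITIONAL.** `C • V^{(c)} = W`
with `V` globally minimal, GOOD ORDINARY at the odd prime `p` (`p ∤ Δ_V`, `p ∤ a_p(V)`), `K = ℚ(θ)`,
`θ² = c`, `ord_v c = 1`: Greenberg's `C_v(V)` (divisible / proper / non-zero — n1011-p10's
`reductionDatum_divisible`, `reductionDatum_plus_ne_top`, `reductionDatum_plus_ne_bot`; inertia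
trivial on the quotient — X2's `reductionDatum_htriv`) transported along `twistTransport` gives `L` with
(1) `IsRamifiedOrdinaryLine W p L`; (2) QUOTIENT SHAPE for every local inertia element (sign by
`galRange K`); (3) LINE SHAPE at ONE local inertia element `σ₀` acting as `2` on `C_v(V)[p]` (p10's
`exists_mem_absInertia_smul_eq_two_nsmul`, from X2's Weil-pairing lemma): `res σ₀ • m = ±2 • m` on `L[p]`.
[cite: GreenbergLNM1716, §2 pp. 63, 69–70] [cite: EmertonPollackWeston2006, §3.1 (eq:ordes) (arXiv:math/0404484 p. 17)]
[cite: GreenbergVatsal2000, §2 p. 26] -/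
theorem exists_isRamifiedOrdinaryLine_shape_of_goodOrd_twist (hp2 : p ≠ 2)
    {v : HeightOneSpectrum (𝓞 ℚ)} (hv : ((p : ℕ) : 𝓞 ℚ) ∈ v.asIdeal)
    (hval : v.valuation ℚ c = WithZero.exp (-1 : ℤ)) (hΔ : ¬ (p : ℤ) ∣ minimalDiscriminantInt V)
    (hord : ¬ (p : ℤ) ∣ V.frobeniusTrace p) :
    ∃ L : LocalDatum ℚ (W.geomPrimaryTorsion p) v, IsRamifiedOrdinaryLine W p L ∧
      (∀ σ ∈ absInertia (v.adicCompletion ℚ),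
        (absGaloisRestrict ℚ (v.adicCompletion ℚ) σ ∈ galRange (K := ℚ) K →
          ∀ x : W.geomPrimaryTorsion p,
            absGaloisRestrict ℚ (v.adicCompletion ℚ) σ • x - x ∈ L.plus) ∧
        (absGaloisRestrict ℚ (v.adicCompletion ℚ) σ ∉ galRange (K := ℚ) K →
          ∀ x : W.geomPrimaryTorsion p,
            absGaloisRestrict ℚ (v.adicCompletion ℚ) σ • x + x ∈ L.plus)) ∧
      (∃ σ₀ ∈ absInertia (v.adicCompletion ℚ), ∀ m ∈ L.plus, p • m = 0 →
        (absGaloisRestrict ℚ (v.adicCompletion ℚ) σ₀ ∈ galRange (K := ℚ) K →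
          absGaloisRestrict ℚ (v.adicCompletion ℚ) σ₀ • m = (2 : ℕ) • m) ∧
        (absGaloisRestrict ℚ (v.adicCompletion ℚ) σ₀ ∉ galRange (K := ℚ) K →
          absGaloisRestrict ℚ (v.adicCompletion ℚ) σ₀ • m = -((2 : ℕ) • m))) := by
  set N := reductionDatum V p hv hΔ with hN
  set t := twistTransport V K hθ hc p hC with ht
  have hsign := twistTransport_sign V K h2 hθ hc p hC
  have htriv := reductionDatum_htriv V p hv hΔ
  obtain ⟨σ₀, hσ₀, h2σ₀⟩ := exists_mem_absInertia_smul_eq_two_nsmul V p hp2 hv hΔ hord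
  refine ⟨twistMap N t hsign, ?_, fun σ hσ ↦ ⟨fun hg x ↦ ?_, fun hg x ↦ ?_⟩,
    ⟨σ₀, hσ₀, fun m hm hpm ↦ ⟨fun hg ↦ ?_, fun hg ↦ ?_⟩⟩⟩
  · exact isRamifiedOrdinaryLine_twistMap_twistTransport V K h2 hθ hc p hC hp2 hv hval N
      (reductionDatum_divisible V p hv hΔ hord) (reductionDatum_plus_ne_top V p hv hΔ hord)
      (reductionDatum_plus_ne_bot V p hv hΔ hord) htriv
  · exact RamifiedOrdinaryLinePotMult.smul_sub_mem_twistMap_of_pos N t hsign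
      (htriv _ (Subgroup.mem_map.2 ⟨σ, hσ, rfl⟩)) (twistTransport_smul_of_mem_galRange V K hθ hc p hC hg) x
  · exact RamifiedOrdinaryLinePotMult.smul_add_mem_twistMap_of_neg N t hsign
      (htriv _ (Subgroup.mem_map.2 ⟨σ, hσ, rfl⟩))
      (twistTransport_smul_of_not_mem_galRange V K h2 hθ hc p hC hg) x
  · have hcm : t.symm m ∈ N.plus := (mem_twistMap_plus_iff N t hsign m).1 hm
    have hpc : p • t.symm m = 0 := by rw [← map_nsmul, hpm, map_zero]
    have h := RamifiedOrdinaryLinePotMult.smul_apply_eq_of_pos t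
      (twistTransport_smul_of_mem_galRange V K hθ hc p hC hg) (h2σ₀ _ hcm hpc)
    rwa [t.apply_symm_apply] at h
  · have hcm : t.symm m ∈ N.plus := (mem_twistMap_plus_iff N t hsign m).1 hm
    have hpc : p • t.symm m = 0 := by rw [← map_nsmul, hpm, map_zero]
    have h := RamifiedOrdinaryLinePotMult.smul_apply_eq_of_neg t
      (twistTransport_smul_of_not_mem_galRange V K h2 hθ hc p hC hg) (h2σ₀ _ hcm hpc)
    rwa [t.apply_symm_apply] at h

end Gord

/-! ### §2 Mixed pairs: (G-ord) twist × (M) twist by the same `c` — the lines match under every congruence -/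

section Pair

variable (V V₁ : WeierstrassCurve ℚ) [V.IsGloballyMinimal] [V.IsElliptic] [V₁.IsGloballyMinimal]
  [V₁.IsElliptic] (K : Type) [Field K] [NumberField K] (h2 : Module.finrank ℚ K = 2) {θ : K} {c : ℚ}
  (hθ : θ ∉ Set.range (algebraMap ℚ K)) (hc : θ ^ 2 = algebraMap ℚ K c) (p : ℕ) [hp : Fact p.Prime]
  {W W₁ : WeierstrassCurve ℚ} {C C₁ : VariableChange ℚ} (hC : C • V.quadraticTwist c = W)
  (hC₁ : C₁ • V₁.quadraticTwist c = W₁)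

include h2 hθ hc hC hC₁ in
/-- **MIXED MATCHING.** `C • V^{(c)} = W` with `V` good ordinary at the odd prime `p`, `C₁ • V₁^{(c)} = W₁`
with `V₁` multiplicative at `p`, `ord_v c = 1`, `K = ℚ(θ)`, `θ² = c`; granted A40/A41 for the (M)
side: there are ramified ordinary lines `L` (of `W`) and `L₁` (of `W₁`) such that EVERY
`Γ_ℚ`-equivariant `e : W[p] ≃+ W₁[p]` satisfies `P ∈ L ↔ eP ∈ L₁`. Direction `W → W₁` runs at p10's
inertia element `σ₀` (acting as `±2` on `L[p]`; quotient shape of `L₁` at `σ₀`); direction `W₁ → W`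
runs at `σ₁` with `χ_p(σ₁) = 2` (acting as `±2` on `L₁[p]`; quotient shape of `L` at `σ₁`).
[cite: EmertonPollackWeston2006, pp. 2–3 and §3.1 (eq:ordes) (arXiv:math/0404484 p. 17)]
[cite: GreenbergVatsal2000, §2 pp. 14–15 and p. 26] [cite: SilvermanATAEC1994, Ch. V Thm. 5.3, Cor. 5.4] -/
theorem exists_lines_matching_of_goodOrd_mult_twists
    (hT40 : Silverman1994_thmV53_tateUniformisation.{0})
    (hT41 : Silverman1994_thmV53_corV54_tateUniformisation.{0}) (hp2 : p ≠ 2)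
    (hΔ : ¬ (p : ℤ) ∣ minimalDiscriminantInt V) (hord : ¬ (p : ℤ) ∣ V.frobeniusTrace p)
    (hmult₁ : V₁.HasMultiplicativeReductionAtPrime p)
    {v : HeightOneSpectrum (𝓞 ℚ)} (hv : ((p : ℕ) : 𝓞 ℚ) ∈ v.asIdeal)
    (hval : v.valuation ℚ c = WithZero.exp (-1 : ℤ)) :
    ∃ (L : LocalDatum ℚ (W.geomPrimaryTorsion p) v) (L₁ : LocalDatum ℚ (W₁.geomPrimaryTorsion p) v),
      IsRamifiedOrdinaryLine W p L ∧ IsRamifiedOrdinaryLine W₁ p L₁ ∧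
      ∀ e : geomTorsion W (p : ℤ) ≃+ geomTorsion W₁ (p : ℤ),
        (∀ (σ : absoluteGaloisGroup ℚ) (P : geomTorsion W (p : ℤ)), e (σ • P) = σ • e P) →
        ∀ P : geomTorsion W (p : ℤ),
          AddSubgroup.inclusion (geomTorsion_le_geomPrimaryTorsion W p) P ∈ L.plus ↔
            AddSubgroup.inclusion (geomTorsion_le_geomPrimaryTorsion W₁ p) (e P) ∈ L₁.plus := by
  obtain ⟨L, hL, hqL, σ₀, hσ₀, hlL⟩ :=
    exists_isRamifiedOrdinaryLine_shape_of_goodOrd_twist V K h2 hθ hc p hC hp2 hv hval hΔ hord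
  obtain ⟨L₁, hL₁, hqL₁, hlL₁⟩ :=
    RamifiedOrdinaryLinePotMult.exists_isRamifiedOrdinaryLine_shape_of_mult_twist
      V₁ K h2 hθ hc p hC₁ hT40 hT41 hp2 hmult₁ hv hval
  have hpp : 2 < p := lt_of_le_of_ne hp.out.two_le (Ne.symm hp2)
  obtain ⟨σ₁, hσ₁, hχ⟩ := exists_mem_absInertia_cyclotomicCharacter_eq_natCast p hv (N := 2)
    (fun h ↦ hp2 ((Nat.prime_dvd_prime_iff_eq hp.out Nat.prime_two).mp h))
  refine ⟨L, L₁, hL, hL₁, fun e he P ↦ ⟨fun hP ↦ ?_, fun hP ↦ ?_⟩⟩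
  · -- `W → W₁` at `σ₀`
    by_cases hg : absGaloisRestrict ℚ (v.adicCompletion ℚ) σ₀ ∈ galRange (K := ℚ) K
    · exact RamifiedOrdinaryLineMatching.inclusion_apply_mem_of_pos L L₁ e he
        (fun m hm hpm ↦ (hlL m hm hpm).1 hg) ((hqL₁ σ₀ hσ₀).1 hg) P hP
    · exact RamifiedOrdinaryLineMatching.inclusion_apply_mem_of_neg L L₁ e he
        (fun m hm hpm ↦ (hlL m hm hpm).2 hg) ((hqL₁ σ₀ hσ₀).2 hg) P hP
  · -- `W₁ → W` at `σ₁`, via `e⁻¹`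
    have he' := RamifiedOrdinaryLineMatching.symm_smul e he
    have key : AddSubgroup.inclusion (geomTorsion_le_geomPrimaryTorsion W p) (e.symm (e P)) ∈ L.plus := by
      by_cases hg : absGaloisRestrict ℚ (v.adicCompletion ℚ) σ₁ ∈ galRange (K := ℚ) K
      · exact RamifiedOrdinaryLineMatching.inclusion_apply_mem_of_pos L₁ L e.symm he'
          (fun m hm hpm ↦ (hlL₁ σ₁ hσ₁ 2 hpp hχ m hm hpm).1 hg) ((hqL σ₁ hσ₁).1 hg) (e P) hP
      · exact RamifiedOrdinaryLineMatching.inclusion_apply_mem_of_neg L₁ L e.symm he'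
          (fun m hm hpm ↦ (hlL₁ σ₁ hσ₁ 2 hpp hχ m hm hpm).2 hg) ((hqL σ₁ hσ₁).2 hg) (e P) hP
    rwa [e.symm_apply_apply] at key

end Pair

/-! ### §3 Class level: `p*`-twist models; X4♯(G-ord)/X3♯(G-ord) ∩ `I₀*` × pot-mult(p) -/

section Classes

variable {W W₁ : WeierstrassCurve ℚ} [W.IsElliptic] [W.IsGloballyMinimal] [W₁.IsElliptic] {p : ℕ}
  [hp : Fact p.Prime]

/-- **(G-ord, `e = 2`) × pot-mult(p) at the same odd `p` (`p = 3` included): lines that match under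
every congruence.** For `E = W` additive of type (G)-ordinary with `semistabilityIndex W p = 2` (its
`p*`-twist model is good ordinary: `TypeGOrd.exists_goodOrd_pStar_twist_model`) and `E₁ = W₁`
potentially multiplicative (`PotMult.exists_mult_pStar_twist_model`), mod A40/A41: `∃ L L₁`, both
`IsRamifiedOrdinaryLine`, respected by EVERY `Γ_ℚ`-equivariant `E[p] ≃+ E₁[p]`.
[cite: EmertonPollackWeston2006, pp. 2–3 and §3.1 (eq:ordes) (arXiv:math/0404484 p. 17)] [cite: GreenbergVatsal2000, §2 p. 26] -/
theorem exists_lines_matching_of_typeGOrd_potMult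
    (hT40 : Silverman1994_thmV53_tateUniformisation.{0})
    (hT41 : Silverman1994_thmV53_corV54_tateUniformisation.{0}) (hp2 : p ≠ 2)
    (hG : TypeGOrd W p) (hadd : Addv W p) (he2 : semistabilityIndex W p = 2) (hpm₁ : PotMult W₁ p)
    {v : HeightOneSpectrum (𝓞 ℚ)} (hv : ((p : ℕ) : 𝓞 ℚ) ∈ v.asIdeal) :
    ∃ (L : LocalDatum ℚ (W.geomPrimaryTorsion p) v) (L₁ : LocalDatum ℚ (W₁.geomPrimaryTorsion p) v),
      IsRamifiedOrdinaryLine W p L ∧ IsRamifiedOrdinaryLine W₁ p L₁ ∧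
      ∀ e : geomTorsion W (p : ℤ) ≃+ geomTorsion W₁ (p : ℤ),
        (∀ (σ : absoluteGaloisGroup ℚ) (P : geomTorsion W (p : ℤ)), e (σ • P) = σ • e P) →
        ∀ P : geomTorsion W (p : ℤ),
          AddSubgroup.inclusion (geomTorsion_le_geomPrimaryTorsion W p) P ∈ L.plus ↔
            AddSubgroup.inclusion (geomTorsion_le_geomPrimaryTorsion W₁ p) (e P) ∈ L₁.plus := by
  obtain ⟨V, _, _, C, hV, hC⟩ := TypeGOrd.exists_goodOrd_pStar_twist_model W p hp2 hG hadd he2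
  obtain ⟨V₁, _, _, C₁, hV₁, hC₁⟩ := hpm₁.exists_mult_pStar_twist_model hp2
  obtain ⟨K, _, _, hK2, θ, hθ, hθ2⟩ := RamifiedOrdinaryLinePotMult.exists_numberField_sq_eq_pStar hp2
  have hΔ := V.not_dvd_minimalDiscriminantInt_of_hasGoodReductionAtPrime' p hV.1
  exact exists_lines_matching_of_goodOrd_mult_twists V V₁ K hK2 hθ hθ2 p hC hC₁ hT40 hT41 hp2 hΔ hV.2
    hV₁ hv (RamifiedOrdinaryLinePotMult.valuation_pStar p v hv)

omit [W.IsGloballyMinimal] in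
/-- **Flipped form: pot-mult(p) × (G-ord, `e = 2`)** — for the (M) consumers with a (G-ord) partner.
[cite: EmertonPollackWeston2006, pp. 2–3 and §3.1 (eq:ordes) (arXiv:math/0404484 p. 17)] -/
theorem exists_lines_matching_of_potMult_typeGOrd [W₁.IsGloballyMinimal]
    (hT40 : Silverman1994_thmV53_tateUniformisation.{0})
    (hT41 : Silverman1994_thmV53_corV54_tateUniformisation.{0}) (hp2 : p ≠ 2) (hpm : PotMult W p)
    (hG₁ : TypeGOrd W₁ p) (hadd₁ : Addv W₁ p) (he2₁ : semistabilityIndex W₁ p = 2)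
    {v : HeightOneSpectrum (𝓞 ℚ)} (hv : ((p : ℕ) : 𝓞 ℚ) ∈ v.asIdeal) :
    ∃ (L : LocalDatum ℚ (W.geomPrimaryTorsion p) v) (L₁ : LocalDatum ℚ (W₁.geomPrimaryTorsion p) v),
      IsRamifiedOrdinaryLine W p L ∧ IsRamifiedOrdinaryLine W₁ p L₁ ∧
      ∀ e : geomTorsion W (p : ℤ) ≃+ geomTorsion W₁ (p : ℤ),
        (∀ (σ : absoluteGaloisGroup ℚ) (P : geomTorsion W (p : ℤ)), e (σ • P) = σ • e P) →
        ∀ P : geomTorsion W (p : ℤ),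
          AddSubgroup.inclusion (geomTorsion_le_geomPrimaryTorsion W p) P ∈ L.plus ↔
            AddSubgroup.inclusion (geomTorsion_le_geomPrimaryTorsion W₁ p) (e P) ∈ L₁.plus := by
  obtain ⟨L₁, L, hL₁, hL, hmatch⟩ :=
    exists_lines_matching_of_typeGOrd_potMult hT40 hT41 hp2 hG₁ hadd₁ he2₁ hpm hv
  refine ⟨L, L₁, hL, hL₁, fun e he P ↦ ?_⟩
  have h := hmatch e.symm (RamifiedOrdinaryLineMatching.symm_smul e he) (e P)
  rw [e.symm_apply_apply] at h
  exact h.symm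

end Classes

end RamifiedOrdinaryLineMatchingMixed

/-! ### §4 Route G: the budget of an X4(M) row from a (G-ord, e = 2) congruent partner -/

section Budget

open RamifiedOrdinaryLineMatchingMixed

variable {W W₁ : WeierstrassCurve ℚ} [W.IsElliptic] [W.IsGloballyMinimal] [W₁.IsElliptic]
  [W₁.IsGloballyMinimal] {p : ℕ} [hp : Fact p.Prime]

/-- **The Route-G budget of an X4(M) row from a (G-ord, `e = 2`) congruent partner — lines and
line-matching DISCHARGED.** `E = W` X4(M) at the odd prime `p`; partner `E₁ = W₁` of type
(G)-ordinary, additive, `semistabilityIndex W₁ p = 2` (X4♯(G-ord) ∩ `I₀*` or X3♯(G-ord) ∩ `I₀*`),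
whose finitely generated cyclotomic dual data are torsion with `μ = 0 ⟹ r₁ ≤ λ` (`h₁`, the shape of
FILE 3 §1 — n1011-p10's partner packages on X4♯(G-ord) rows); a PLAIN `Γ_ℚ`-equivariant
`E[p] ≃+ E₁[p]`; `Σ₀ ∌ p` outside which both are good. Then `BudgetLeLambdaAt p W b` for every
`b ≤ r₁ + Σ_{w∈Σ₀} (δ(E₁,w) − δ(E,w))` (EPW 3.3.2 / 3.3.3 (2) + Lemma 5.1.5 via FILE 3's
`budgetLeLambdaAt_of_epw_of_partnerRank`, the two lines and the line-respecting clause supplied by §3).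
[cite: EmertonPollackWeston2006, Thm. 3.3.2, Thm. 3.3.3 (2) (arXiv:math/0404484 p. 19), Lemma 5.1.5 (p. 30) and pp. 2–3]
[cite: SilvermanATAEC1994, Ch. V Thm. 5.3, Cor. 5.4] -/
theorem ClassX4M.budgetLeLambdaAt_of_epw_of_gordTypePartner_of_congr
    (hEPW : muLambdaAlg_transfer_of_torsionIso_potOrd)
    (hT40 : Silverman1994_thmV53_tateUniformisation.{0})
    (hT41 : Silverman1994_thmV53_corV54_tateUniformisation.{0})
    (hX : ClassX4M W p) (hG₁ : TypeGOrd W₁ p) (hadd₁ : Addv W₁ p) (he2₁ : semistabilityIndex W₁ p = 2)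
    {v : HeightOneSpectrum (𝓞 ℚ)} (hv : ((p : ℕ) : 𝓞 ℚ) ∈ v.asIdeal)
    (hcong : ∃ e : geomTorsion W (p : ℤ) ≃+ geomTorsion W₁ (p : ℤ),
      ∀ (σ : absoluteGaloisGroup ℚ) (P : geomTorsion W (p : ℤ)), e (σ • P) = σ • e P)
    (S₀ : Finset (HeightOneSpectrum (𝓞 ℚ))) (hS₀ : ∀ w ∈ S₀, ((p : ℕ) : 𝓞 ℚ) ∉ w.asIdeal)
    (hS : ∀ w : HeightOneSpectrum (𝓞 ℚ), w ∉ S₀ → ((p : ℕ) : 𝓞 ℚ) ∉ w.asIdeal →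
      W.HasGoodReductionAt w)
    (hS₁ : ∀ w : HeightOneSpectrum (𝓞 ℚ), w ∉ S₀ → ((p : ℕ) : 𝓞 ℚ) ∉ w.asIdeal →
      W₁.HasGoodReductionAt w)
    {r₁ : ℕ}
    (h₁ : ∀ {κ : ZpExtension ℚ p} {γ : absoluteGaloisGroup ℚ},
      κ.IsCyclotomic → κ.IsTopGenerator γ → IsCyclotomicVariable p γ →
      ∀ (D₁ : W₁.SelmerDualData κ γ) [Module.Finite (IwasawaAlgebra p) D₁.X],
        D₁.IsTorsion ∧ (D₁.mu = 0 → r₁ ≤ lambdaInvariant p D₁.X))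
    {b : ℕ} (hb : (b : ℤ) ≤ r₁ + ∑ w ∈ S₀, ((delta W₁ p w : ℤ) - (delta W p w : ℤ))) :
    BudgetLeLambdaAt p W b := by
  obtain ⟨L, L₁, hL, hL₁, hmatch⟩ := exists_lines_matching_of_potMult_typeGOrd hT40 hT41 hX.p_ne_two
    (ClassX4M.potMult W p hX) hG₁ hadd₁ he2₁ hv
  obtain ⟨e, he⟩ := hcong
  exact budgetLeLambdaAt_of_epw_of_partnerRank hEPW hX.p_ne_two hv hL hL₁ hX.irr ⟨e, he, hmatch e he⟩
    S₀ hS₀ hS hS₁ h₁ hb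

end Budget

end Summit.BirchSwinnertonDyer.Rank1Residual.AdditivePotMult

end
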